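import Summits.QuantumFields.BalabanUV.Beta.RemainderCouplingHolomorphyAllOrders
import Summits.QuantumFields.BalabanUV.Beta.EriceRemainderEnclosureHolomorphyNecessity

/-!
# RemainderCouplingHolomorphyAllOrdersNecessity — (D4-J7b) THE SCALE-UNIFORMITY OF THE CONSTANTS IN (D4-J7)'s
# `junction_of_p264AllOrders` IS LOAD-BEARING, IN (D4-J7)'s OWN CURRENCY: print's p. 264 clause in its PER-j reading — smooth
# sections, ALL orders, derivatives WITHIN [0, γ₀], constants `C k m` allowed to depend on the scale — does NOT give the junction

Cell `pub-balaban`, β-function sub-cell, BINDER row D4 (`HOME/BINDER-OWNERS.md`; this file by the row OWNER lineage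
`b2b-balaban-beta-an4`, generation 62), β-FLOW TEAM duty (1); FREEZE (0) honoured (def-free; lineage series).  OCCASION: (D4-J7)
`RemainderCouplingHolomorphyAllOrders` (p297326) proves `junction_of_p264AllOrders` with constants `C : ℕ → ℝ` quantified OUTSIDE the
scale and says the other conjuncts are idle «two-sided by (E16)»; co-owner d4-p3 g32's kernel chair X54 (C-d4p3-92) certified the
scale-indexed mutant N3 (`C : ℕ → ℕ → ℝ`) FALSE IN TRUTH by a reader's junction J-q on (E16)'s entire Markov family, and both co-owners
offered the host's chair to the owner (journal l.34327 INFO-3; l.34239).  This file is that junction as a tree theorem, in (D4-J7)'s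
exact currency (`ContDiffOn ℝ ⊤ … (Icc 0 γ₀)`, `iteratedDerivWithin … (Icc 0 γ₀)`), so that the sentence «every conjunct of print's
clause other than the m = 1 line READ UNIFORM IN j is idle for (D4)» has both directions in the kernel next to each other.
PROOF TEXT: d4-p3 g32's probe `HOME/b2b-balaban-beta-d4-p3/g32/xread2/ProbeConcatJ7.lean` §J-q, verbatim modulo the carrier name —
credited; (E16)'s lemmas `expfam_split_exists`, `expfam_contDiff`, `expfam_section_eq`, `expfam_iteratedDeriv_bounded`,
`expfam_junction_elim` (d4-p2 g22, p295224) BY NAME.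

HONEST FRAMING (BETA-SPEC §0.2, verbatim and binding). *"Discharging BetaPertH makes Bałaban's UV stability UNCONDITIONAL — a
real constructive-QFT result; it is NOT the continuum limit and NOT the Clay problem."*  THIS MODULE DISCHARGES NOTHING: a toy
family on typed shapes; nothing of Bałaban's (1.22) asserted, constructed or instantiated; row D4 class UNCHANGED (critical-path
width 0; instance 0∕1; D4 DISCHARGE NO DATE).  NOT BetaPertH, NOT continuum, NOT Clay.  HONEST DEPENDENCY: continuum YM on T⁴ ⇐
BetaPertH ∧ nine spine estimates (0/9 proved); BetaPertH ⇐ (D1) ∧ (D4) ∧ CAP+tail; G-an2-4 gates asym, D1 and NE2/3/4.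

WHAT IS PROVED ([folklore]; 0 sorry; 0 `def`): `perScale_p264Clause_expfam` ((E16)'s family with r₀ = 1 satisfies (D4-J7)'s clause
hypothesis on [0, 1] with SCALE-INDEXED constants `C k m` — sections history-free, `iteratedDerivWithin = iteratedDeriv` on
`uniqueDiffOn_Icc`); **`not_junction_of_perScale_p264Clause`** (J-q: the per-j clause, all orders, does NOT imply the junction);
END `p264Clause_uniformity_census` (side by side: uniform `C m` ⟹ junction — (D4-J7) — and per-scale `C k m` ⇏ junction).
[cite: Balaban1987RG1, §1 p.264 tl.25–27 — shape only, nothing asserted] -/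

noncomputable section

open Metric Set

namespace Summit.QuantumFields.BalabanUV.Beta.RemainderCouplingHolomorphyAllOrdersNecessity

open Literature.MathematicalPhysics.QuantumFieldTheory.Balaban1983to89
open Literature.MathematicalPhysics.QuantumFieldTheory.Balaban1983to89.FlowStep (HBeta)
open Literature.MathematicalPhysics.QuantumFieldTheory.Balaban1983to89.Beta.RemainderChain (RemainderConst)
open Literature.MathematicalPhysics.QuantumFieldTheory.Balaban1983to89.BetaDerivClause (LastVarDerivBound)
open Summit.QuantumFields.BalabanUV.Beta.RemainderCouplingHolomorphyAllOrders (junction_of_p264AllOrders)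
open Summit.QuantumFields.BalabanUV.Beta.EriceRemainderEnclosureHolomorphyNecessity
  (expfam_split_exists expfam_contDiff expfam_section_eq expfam_iteratedDeriv_bounded expfam_junction_elim)

/-- **(E16)'s entire Markov family (r₀ = 1) MEETS (D4-J7)'s clause hypothesis on `[0, 1]` WITH SCALE-INDEXED CONSTANTS**: there are
`C k m` with every section `C^∞` on `[0, 1]` and `|iteratedDerivWithin m section (Icc 0 1) g| ≤ C k m` for all k, p, m, g ∈ [0, 1]
(the sections do not depend on the history — `expfam_section_eq`; per-(k, m) bounds from `expfam_iteratedDeriv_bounded` at the zero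
history; within = unrestricted on `[0, 1]` by `uniqueDiffOn_Icc`).  Proof text: d4-p3 g32's X54 probe §J-q. [folklore] -/
theorem perScale_p264Clause_expfam {β : HBeta}
    (hβ : ∀ (k : ℕ) (p : Fin (k + 1) → ℝ), β k p = 1 * (1 - Real.exp (-(((k : ℝ) + 1) * p (Fin.last k))))) :
    ∃ C : ℕ → ℕ → ℝ, ∀ (k : ℕ) (p : Fin (k + 1) → ℝ), p ∈ B12Beta.HistBox (1 : ℝ) k →
      ContDiffOn ℝ ⊤ (fun s : ℝ => β k (Function.update p (Fin.last k) s)) (Icc (0 : ℝ) 1) ∧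
      ∀ (m : ℕ) (g : ℝ), g ∈ Icc (0 : ℝ) 1 →
        |iteratedDerivWithin m (fun s : ℝ => β k (Function.update p (Fin.last k) s)) (Icc (0 : ℝ) 1) g| ≤ C k m := by
  -- per-(scale, order) constants on [0, 1], read off the zero history (the sections are history-free)
  choose C hC using fun (k m : ℕ) => expfam_iteratedDeriv_bounded hβ k (fun _ : Fin (k + 1) => (0 : ℝ)) m 1
  refine ⟨C, fun k p _ => ⟨(expfam_contDiff hβ k p).contDiffOn, fun m g hg => ?_⟩⟩
  have hsec : (fun s : ℝ => β k (Function.update p (Fin.last k) s))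
      = fun s : ℝ => β k (Function.update (fun _ : Fin (k + 1) => (0 : ℝ)) (Fin.last k) s) := by
    rw [expfam_section_eq hβ k p, expfam_section_eq hβ k]
  rw [iteratedDerivWithin_eq_iteratedDeriv (uniqueDiffOn_Icc one_pos)
    ((expfam_contDiff hβ k p).contDiffAt.of_le le_top) hg, hsec, ← Real.norm_eq_abs]
  exact hC k m g hg

/-- **J-q — THE SCALE-UNIFORMITY OF `C` IN (D4-J7)'s `junction_of_p264AllOrders` IS LOAD-BEARING**: it is FALSE that for every
history family, split and γ₀ > 0, print's p. 264 clause in its PER-j reading (smooth sections on [0, γ₀], all orders, derivatives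
within the interval, constants `C k m` depending on the scale) implies the junction shape of (D4) — (E16)'s entire Markov family at
r₀ = γ₀ = 1 meets the per-j clause (`perScale_p264Clause_expfam`) and has no junction (`expfam_junction_elim`).  The false-in-truth
certificate of d4-p3's mutant N3; with `C m` uniform in the scale the implication HOLDS ((D4-J7) `junction_of_p264AllOrders`).
[cite: Balaban1987RG1, §1 p.264 tl.25–27 — shape only, nothing asserted] -/
theorem not_junction_of_perScale_p264Clause :
    ¬ (∀ (β : HBeta) (S : B12Beta.OneLoopSplit β) (γ₀ : ℝ), 0 < γ₀ → ∀ (C : ℕ → ℕ → ℝ),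
      (∀ (k : ℕ) (p : Fin (k + 1) → ℝ), p ∈ B12Beta.HistBox γ₀ k →
        ContDiffOn ℝ ⊤ (fun s : ℝ => β k (Function.update p (Fin.last k) s)) (Icc (0 : ℝ) γ₀) ∧
        ∀ (m : ℕ) (g : ℝ), g ∈ Icc (0 : ℝ) γ₀ →
          |iteratedDerivWithin m (fun s : ℝ => β k (Function.update p (Fin.last k) s)) (Icc (0 : ℝ) γ₀) g| ≤ C k m) →
      ∀ b : ℝ, 0 < b → ∃ γ₁ : ℝ, 0 < γ₁ ∧ ∀ γ : ℝ, 0 < γ → γ ≤ γ₁ →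
        ∃ r : ℝ, 0 ≤ r ∧ r < b ∧ RemainderConst S γ r) := by
  intro hAll
  let βx : HBeta := fun k p => (1 : ℝ) * (1 - Real.exp (-(((k : ℝ) + 1) * p (Fin.last k))))
  have hβx : ∀ (k : ℕ) (p : Fin (k + 1) → ℝ), βx k p = 1 * (1 - Real.exp (-(((k : ℝ) + 1) * p (Fin.last k)))) :=
    fun _ _ => rfl
  obtain ⟨S, hS0⟩ := expfam_split_exists hβx
  obtain ⟨C, hClause⟩ := perScale_p264Clause_expfam hβx
  exact (lt_irrefl (1 : ℝ)) (expfam_junction_elim hβx S hS0 one_pos (hAll βx S 1 one_pos C hClause))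

/-- **END — THE UNIFORMITY CENSUS OF PRINT'S p. 264 CLAUSE FOR (D4), BOTH DIRECTIONS BY NAME.**  (a) Read UNIFORM in j (one
`C m` for all scales and histories), the clause enters R-264's chain through its m = 1 line and gives the junction — (D4-J7)
`junction_of_p264AllOrders`; (b) read PER j (`C k m`), all orders and smoothness notwithstanding, it does NOT —
`not_junction_of_perScale_p264Clause`.  The uniformity in the scale is the whole unprinted datum; instance 0∕1; class UNCHANGED.
[cite: Balaban1987RG1, §1 p.264 tl.25–27 — shape only, nothing asserted] -/
theorem p264Clause_uniformity_census :
    (∀ (β : HBeta) (S : B12Beta.OneLoopSplit β) (γ₀ : ℝ), 0 < γ₀ → ∀ (C : ℕ → ℝ),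
      (∀ (k : ℕ) (p : Fin (k + 1) → ℝ), p ∈ B12Beta.HistBox γ₀ k →
        ContDiffOn ℝ ⊤ (fun s : ℝ => β k (Function.update p (Fin.last k) s)) (Icc (0 : ℝ) γ₀) ∧
        ∀ (m : ℕ) (g : ℝ), g ∈ Icc (0 : ℝ) γ₀ →
          |iteratedDerivWithin m (fun s : ℝ => β k (Function.update p (Fin.last k) s)) (Icc (0 : ℝ) γ₀) g| ≤ C m) →
      LastVarDerivBound β (C 1) γ₀ ∧
      ∀ b : ℝ, 0 < b → ∃ γ₁ : ℝ, 0 < γ₁ ∧ ∀ γ : ℝ, 0 < γ → γ ≤ γ₁ →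
        ∃ r : ℝ, 0 ≤ r ∧ r < b ∧ RemainderConst S γ r) ∧
    ¬ (∀ (β : HBeta) (S : B12Beta.OneLoopSplit β) (γ₀ : ℝ), 0 < γ₀ → ∀ (C : ℕ → ℕ → ℝ),
      (∀ (k : ℕ) (p : Fin (k + 1) → ℝ), p ∈ B12Beta.HistBox γ₀ k →
        ContDiffOn ℝ ⊤ (fun s : ℝ => β k (Function.update p (Fin.last k) s)) (Icc (0 : ℝ) γ₀) ∧
        ∀ (m : ℕ) (g : ℝ), g ∈ Icc (0 : ℝ) γ₀ →
          |iteratedDerivWithin m (fun s : ℝ => β k (Function.update p (Fin.last k) s)) (Icc (0 : ℝ) γ₀) g| ≤ C k m) →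
      ∀ b : ℝ, 0 < b → ∃ γ₁ : ℝ, 0 < γ₁ ∧ ∀ γ : ℝ, 0 < γ → γ ≤ γ₁ →
        ∃ r : ℝ, 0 ≤ r ∧ r < b ∧ RemainderConst S γ r) :=
  ⟨fun _ S _ hγ₀ _ hClause => let h := junction_of_p264AllOrders S hγ₀ hClause; ⟨h.1, h.2.2⟩,
    not_junction_of_perScale_p264Clause⟩

end Summit.QuantumFields.BalabanUV.Beta.RemainderCouplingHolomorphyAllOrdersNecessity

end
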